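import Summits.RiemannHypothesis.RiemannHypothesis.Theorems.WeilTwoPrimeDeflE72Base
import Literature.NumberTheory.LFunctions.WeilBlockRowsFast
import HarnessLib

/-!
# Deflated two-prime certificate (weilCertDeflE72): the Bessel block claim `Hp = C H Cᵀ` (parity 0), rows 90–94, fast check

`WeilCert.checkHpRowT` (linear traversals) instead of the indexed `checkHpRow` decide.  Pure proof file.
-/

noncomputable section

namespace Summit.RiemannHypothesis.RiemannHypothesis.Theorems.EvenWinsBeyondArch

open Literature.NumberTheory.LFunctions

set_option maxHeartbeats 0 in
/-- Fast kernel check of claim row 90 of `Hp = C H Cᵀ` (parity 0; linear traversals, triangular `C`). [folklore] -/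
theorem checkHpRowT0_90_weilCertDeflE72 : weilCertDeflE72Base.checkHpRowT weilCertDeflE72HpE 0 90 = true := by
  decide +kernel

/-- Claim row 90 of `Hp = C H Cᵀ` (parity 0), from the fast check. [folklore] -/
theorem checkHpRow0_90_weilCertDeflE72 : weilCertDeflE72Base.checkHpRow weilCertDeflE72HpE 0 90 = true :=
  WeilCert.checkHpRow_of_T checkHpRowT0_90_weilCertDeflE72

set_option maxHeartbeats 0 in
/-- Fast kernel check of claim row 91 of `Hp = C H Cᵀ` (parity 0; linear traversals, triangular `C`). [folklore] -/
theorem checkHpRowT0_91_weilCertDeflE72 : weilCertDeflE72Base.checkHpRowT weilCertDeflE72HpE 0 91 = true := by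
  decide +kernel

/-- Claim row 91 of `Hp = C H Cᵀ` (parity 0), from the fast check. [folklore] -/
theorem checkHpRow0_91_weilCertDeflE72 : weilCertDeflE72Base.checkHpRow weilCertDeflE72HpE 0 91 = true :=
  WeilCert.checkHpRow_of_T checkHpRowT0_91_weilCertDeflE72

set_option maxHeartbeats 0 in
/-- Fast kernel check of claim row 92 of `Hp = C H Cᵀ` (parity 0; linear traversals, triangular `C`). [folklore] -/
theorem checkHpRowT0_92_weilCertDeflE72 : weilCertDeflE72Base.checkHpRowT weilCertDeflE72HpE 0 92 = true := by
  decide +kernel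

/-- Claim row 92 of `Hp = C H Cᵀ` (parity 0), from the fast check. [folklore] -/
theorem checkHpRow0_92_weilCertDeflE72 : weilCertDeflE72Base.checkHpRow weilCertDeflE72HpE 0 92 = true :=
  WeilCert.checkHpRow_of_T checkHpRowT0_92_weilCertDeflE72

set_option maxHeartbeats 0 in
/-- Fast kernel check of claim row 93 of `Hp = C H Cᵀ` (parity 0; linear traversals, triangular `C`). [folklore] -/
theorem checkHpRowT0_93_weilCertDeflE72 : weilCertDeflE72Base.checkHpRowT weilCertDeflE72HpE 0 93 = true := by
  decide +kernel

/-- Claim row 93 of `Hp = C H Cᵀ` (parity 0), from the fast check. [folklore] -/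
theorem checkHpRow0_93_weilCertDeflE72 : weilCertDeflE72Base.checkHpRow weilCertDeflE72HpE 0 93 = true :=
  WeilCert.checkHpRow_of_T checkHpRowT0_93_weilCertDeflE72

set_option maxHeartbeats 0 in
/-- Fast kernel check of claim row 94 of `Hp = C H Cᵀ` (parity 0; linear traversals, triangular `C`). [folklore] -/
theorem checkHpRowT0_94_weilCertDeflE72 : weilCertDeflE72Base.checkHpRowT weilCertDeflE72HpE 0 94 = true := by
  decide +kernel

/-- Claim row 94 of `Hp = C H Cᵀ` (parity 0), from the fast check. [folklore] -/
theorem checkHpRow0_94_weilCertDeflE72 : weilCertDeflE72Base.checkHpRow weilCertDeflE72HpE 0 94 = true :=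
  WeilCert.checkHpRow_of_T checkHpRowT0_94_weilCertDeflE72

end Summit.RiemannHypothesis.RiemannHypothesis.Theorems.EvenWinsBeyondArch
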